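import Mathlib
import Summits.KontsevichZagierPeriods.KontsevichZagierPeriods.Theorems.SoloInformedKummerZetaKernel
import Summits.KontsevichZagierPeriods.KontsevichZagierPeriods.Theorems.SoloInformedLegendreRelation
import Literature.NumberTheory.Transcendental.EllIterRep
import HarnessLib
import HarnessLib.Audit

/-!
# Kummer family IV: the hyperbolic reciprocity law for the third kind, II — semialgebraicity and integrability (s41)

Second file of THEOREM XXVIII(a) (§6quattuordecies of the residency paper; file I =
`SoloInformedKummerZetaKernel`).  With `κ(z) = (√(1−z²))⁻¹(√(1−mz²))⁻¹`, the potential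
`Φ(a,b) = m a² κ(a)·(b W(b)/(1 − m a² b²))·κ(b)` and its `b`-derivative `R(a,b)κ(a)κ(b)` of file I,
this file supplies the analytic inputs of the two moves of file III
(`SoloInformedKummerZetaMoves`): `ℚ`-SEMIALGEBRAICITY of `Φ` and of `Rκκ` — both are
`rational × four inverse square roots of polynomials`, proved on the parameter box
`(−1,1)² × (0,1)` in the coordinates `(a,b,m)` and pulled back along `w ↦ (w, m)` for an algebraic
modulus `m`, the closed face `b = 1` being glued on by the vanishing of `(√0)⁻¹` — and
INTEGRABILITY of `Rκκ` on every semialgebraic `S ⊆ (0,1) × [0,1]` from the domination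
`|Rκκ| ≤ 6(1−m)⁻³(√(1−a))⁻¹(√(1−b))⁻¹` of file I; also the bound
`|Φ(a,b)| ≤ (1−m)⁻¹(√(1−a))⁻¹(√(1−m))⁻¹` used for the boundary term of the deformation.

References: M. Kontsevich, D. Zagier, *Periods* (2001), §1.1–1.2; J. Bochnak, M. Coste,
M.-F. Roy, *Real Algebraic Geometry* (1998), §2.2; this work (solo-informed s41).
-/

noncomputable section

open MeasureTheory Set Filter
open scoped Classical

open Literature.NumberTheory.Transcendental Literature.NumberTheory.Transcendental.KZ
open Literature.ModelTheory.ExponentialFields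

namespace Summit.KontsevichZagierPeriods.KontsevichZagierPeriods.Theorems

/-! ### Semialgebraicity on the parameter box `(−1,1) × (−1,1) × (0,1)` (coordinates `a, b, m`) -/

/-- The parameter box is `ℚ`-semialgebraic. [folklore] -/
theorem soloInformed_kummerZeta_isSemialgebraic_box3 :
    IsSemialgebraic ℚ {u : Fin 3 → ℝ | u 0 ∈ Ioo (-1:ℝ) 1 ∧ u 1 ∈ Ioo (-1:ℝ) 1 ∧
      u 2 ∈ Ioo (0:ℝ) 1} := by
  have hn1 : IsAlgebraic ℚ (-1:ℝ) := isAlgebraic_one.neg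
  have h := ((isSemialgebraic_setOf_const_lt_apply hn1 (0 : Fin 3)).inter
    (isSemialgebraic_setOf_apply_lt_const isAlgebraic_one (0 : Fin 3))).inter
    (((isSemialgebraic_setOf_const_lt_apply hn1 (1 : Fin 3)).inter
      (isSemialgebraic_setOf_apply_lt_const isAlgebraic_one (1 : Fin 3))).inter
      ((isSemialgebraic_setOf_const_lt_apply isAlgebraic_zero (2 : Fin 3)).inter
        (isSemialgebraic_setOf_apply_lt_const isAlgebraic_one (2 : Fin 3))))
  convert h using 1
  ext u
  simp only [mem_inter_iff, mem_setOf_eq, mem_Ioo]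

/-- On the parameter box all radicands and the denominator are positive. [folklore] -/
theorem soloInformed_kummerZeta_box3_pos {u : Fin 3 → ℝ}
    (hu : u ∈ {u : Fin 3 → ℝ | u 0 ∈ Ioo (-1:ℝ) 1 ∧ u 1 ∈ Ioo (-1:ℝ) 1 ∧ u 2 ∈ Ioo (0:ℝ) 1}) :
    (0 < 1 - u 0 ^ 2 ∧ 0 < 1 - u 2 * u 0 ^ 2) ∧ (0 < 1 - u 1 ^ 2 ∧ 0 < 1 - u 2 * u 1 ^ 2) ∧
      0 < 1 - u 2 * u 0 ^ 2 * u 1 ^ 2 := by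
  obtain ⟨h0, h1, h2⟩ := hu
  have ha : u 0 ^ 2 < 1 := by nlinarith [h0.1, h0.2]
  have hb : u 1 ^ 2 < 1 := by nlinarith [h1.1, h1.2]
  exact ⟨soloInformed_kummerZeta_radicands_pos h2 ha, soloInformed_kummerZeta_radicands_pos h2 hb,
    (soloInformed_kummerZeta_denom_pos h2 ha.le hb.le).2⟩

/-- The kernel `κ(a)κ(b)` (modulus `m = u 2`) is `ℚ`-semialgebraic on the parameter box.
[this work] -/
theorem soloInformed_kummerZeta_sa3_kernel :
    IsSemialgebraicFunOn ℚ {u : Fin 3 → ℝ | u 0 ∈ Ioo (-1:ℝ) 1 ∧ u 1 ∈ Ioo (-1:ℝ) 1 ∧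
      u 2 ∈ Ioo (0:ℝ) 1}
      (fun u => (√(1 - u 0 ^ 2))⁻¹ * (√(1 - u 2 * u 0 ^ 2))⁻¹ *
        ((√(1 - u 1 ^ 2))⁻¹ * (√(1 - u 2 * u 1 ^ 2))⁻¹)) := by
  have hT := soloInformed_kummerZeta_isSemialgebraic_box3
  have h1 := soloInformed_sa_inv_sqrt_aeval hT (1 - MvPolynomial.X 0 ^ 2) fun u hu => by
    simpa only [map_sub, map_one, map_pow, map_mul, MvPolynomial.aeval_X] using
      (soloInformed_kummerZeta_box3_pos hu).1.1
  have h2 := soloInformed_sa_inv_sqrt_aeval hT (1 - MvPolynomial.X 2 * MvPolynomial.X 0 ^ 2)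
    fun u hu => by
    simpa only [map_sub, map_one, map_pow, map_mul, MvPolynomial.aeval_X] using
      (soloInformed_kummerZeta_box3_pos hu).1.2
  have h3 := soloInformed_sa_inv_sqrt_aeval hT (1 - MvPolynomial.X 1 ^ 2) fun u hu => by
    simpa only [map_sub, map_one, map_pow, map_mul, MvPolynomial.aeval_X] using
      (soloInformed_kummerZeta_box3_pos hu).2.1.1
  have h4 := soloInformed_sa_inv_sqrt_aeval hT (1 - MvPolynomial.X 2 * MvPolynomial.X 1 ^ 2)
    fun u hu => by
    simpa only [map_sub, map_one, map_pow, map_mul, MvPolynomial.aeval_X] using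
      (soloInformed_kummerZeta_box3_pos hu).2.1.2
  refine (IsSemialgebraicFunOn.mul_holds (IsSemialgebraicFunOn.mul_holds h1 h2)
    (IsSemialgebraicFunOn.mul_holds h3 h4)).congr fun u _ => ?_
  simp only [Pi.mul_apply, map_sub, map_one, map_pow, map_mul, MvPolynomial.aeval_X]

/-- `R` over a common denominator. [this work] -/
theorem soloInformed_kummerZeta_R_eq {m a b : ℝ} (hD : 1 - m * a ^ 2 * b ^ 2 ≠ 0) :
    soloInformedKummerZetaR m a b =
      m * a ^ 2 * ((1 - 2 * (1 + m) * b ^ 2 + 3 * m * b ^ 4) * (1 - m * a ^ 2 * b ^ 2) +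
        2 * m * a ^ 2 * b ^ 2 * ((1 - b ^ 2) * (1 - m * b ^ 2))) /
        (1 - m * a ^ 2 * b ^ 2) ^ 2 := by
  unfold soloInformedKummerZetaR
  field_simp

/-- The potential `Φ(a,b)` (modulus `u 2`) is `ℚ`-semialgebraic on the parameter box. [this work] -/
theorem soloInformed_kummerZeta_sa3_Phi :
    IsSemialgebraicFunOn ℚ {u : Fin 3 → ℝ | u 0 ∈ Ioo (-1:ℝ) 1 ∧ u 1 ∈ Ioo (-1:ℝ) 1 ∧
      u 2 ∈ Ioo (0:ℝ) 1} (fun u => soloInformedKummerZetaPhi (u 2) (u 0) (u 1)) := by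
  have hT := soloInformed_kummerZeta_isSemialgebraic_box3
  have hq : ∀ u ∈ {u : Fin 3 → ℝ | u 0 ∈ Ioo (-1:ℝ) 1 ∧ u 1 ∈ Ioo (-1:ℝ) 1 ∧ u 2 ∈ Ioo (0:ℝ) 1},
      MvPolynomial.aeval u (1 - MvPolynomial.X 2 * MvPolynomial.X 0 ^ 2 * MvPolynomial.X 1 ^ 2 :
        MvPolynomial (Fin 3) ℚ) ≠ 0 := fun u hu => by
    simpa only [map_sub, map_one, map_pow, map_mul, MvPolynomial.aeval_X] using
      (soloInformed_kummerZeta_box3_pos hu).2.2.ne'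
  refine ((isSemialgebraicFunOn_aeval_div_aeval hT
    (MvPolynomial.X 2 * MvPolynomial.X 0 ^ 2 * (MvPolynomial.X 1 *
      ((1 - MvPolynomial.X 1 ^ 2) * (1 - MvPolynomial.X 2 * MvPolynomial.X 1 ^ 2))))
    (1 - MvPolynomial.X 2 * MvPolynomial.X 0 ^ 2 * MvPolynomial.X 1 ^ 2) hq).mul_holds
    soloInformed_kummerZeta_sa3_kernel).congr fun u _ => ?_
  simp only [Pi.mul_apply, map_sub, map_one, map_pow, map_mul, MvPolynomial.aeval_X,
    soloInformedKummerZetaPhi]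
  ring

/-- The derivative `R(a,b)κ(a)κ(b)` (modulus `u 2`) is `ℚ`-semialgebraic on the parameter box.
[this work] -/
theorem soloInformed_kummerZeta_sa3_g :
    IsSemialgebraicFunOn ℚ {u : Fin 3 → ℝ | u 0 ∈ Ioo (-1:ℝ) 1 ∧ u 1 ∈ Ioo (-1:ℝ) 1 ∧
      u 2 ∈ Ioo (0:ℝ) 1}
      (fun u => soloInformedKummerZetaR (u 2) (u 0) (u 1) *
        ((√(1 - u 0 ^ 2))⁻¹ * (√(1 - u 2 * u 0 ^ 2))⁻¹) *
        ((√(1 - u 1 ^ 2))⁻¹ * (√(1 - u 2 * u 1 ^ 2))⁻¹)) := by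
  have hT := soloInformed_kummerZeta_isSemialgebraic_box3
  have hq : ∀ u ∈ {u : Fin 3 → ℝ | u 0 ∈ Ioo (-1:ℝ) 1 ∧ u 1 ∈ Ioo (-1:ℝ) 1 ∧ u 2 ∈ Ioo (0:ℝ) 1},
      MvPolynomial.aeval u ((1 - MvPolynomial.X 2 * MvPolynomial.X 0 ^ 2 * MvPolynomial.X 1 ^ 2) ^ 2 :
        MvPolynomial (Fin 3) ℚ) ≠ 0 := fun u hu => by
    simpa only [map_sub, map_one, map_pow, map_mul, MvPolynomial.aeval_X] using
      pow_ne_zero 2 (soloInformed_kummerZeta_box3_pos hu).2.2.ne'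
  refine ((isSemialgebraicFunOn_aeval_div_aeval hT
    (MvPolynomial.X 2 * MvPolynomial.X 0 ^ 2 *
      ((1 - 2 * (1 + MvPolynomial.X 2) * MvPolynomial.X 1 ^ 2 + 3 * MvPolynomial.X 2 *
          MvPolynomial.X 1 ^ 4) * (1 - MvPolynomial.X 2 * MvPolynomial.X 0 ^ 2 * MvPolynomial.X 1 ^ 2) +
        2 * MvPolynomial.X 2 * MvPolynomial.X 0 ^ 2 * MvPolynomial.X 1 ^ 2 *
          ((1 - MvPolynomial.X 1 ^ 2) * (1 - MvPolynomial.X 2 * MvPolynomial.X 1 ^ 2))))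
    ((1 - MvPolynomial.X 2 * MvPolynomial.X 0 ^ 2 * MvPolynomial.X 1 ^ 2) ^ 2) hq).mul_holds
    soloInformed_kummerZeta_sa3_kernel).congr fun u hu => ?_
  have hR := soloInformed_kummerZeta_R_eq (soloInformed_kummerZeta_box3_pos hu).2.2.ne'
  simp only [Pi.mul_apply, map_sub, map_add, map_one, map_pow, map_mul, map_ofNat,
    MvPolynomial.aeval_X]
  rw [hR]
  ring

/-! ### Semialgebraicity in the plane, modulus fixed -/

/-- For `m ∈ (0,1)` algebraic, `Φ(w₀,w₁)` and `R(w₀,w₁)κ(w₀)κ(w₁)` are `ℚ`-semialgebraic on every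
semialgebraic `S ⊆ (−1,1)²`: pull back along `w ↦ (w, m)`. [this work] -/
theorem soloInformed_kummerZeta_sa_two {m : ℝ} (hm : m ∈ Ioo (0:ℝ) 1) (hma : IsAlgebraic ℚ m)
    {S : Set (Fin 2 → ℝ)} (hS : IsSemialgebraic ℚ S)
    (hw : ∀ w ∈ S, w 0 ∈ Ioo (-1:ℝ) 1 ∧ w 1 ∈ Ioo (-1:ℝ) 1) :
    IsSemialgebraicFunOn ℚ S (fun w => soloInformedKummerZetaPhi m (w 0) (w 1)) ∧
    IsSemialgebraicFunOn ℚ S (fun w => soloInformedKummerZetaR m (w 0) (w 1) *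
      ((√(1 - w 0 ^ 2))⁻¹ * (√(1 - m * w 0 ^ 2))⁻¹) *
      ((√(1 - w 1 ^ 2))⁻¹ * (√(1 - m * w 1 ^ 2))⁻¹)) := by
  have hφ : IsSemialgebraicMapOn ℚ S (fun w => (Fin.snoc w m : Fin 3 → ℝ)) := by
    refine IsSemialgebraicMapOn.of_forall hS fun j => ?_
    induction j using Fin.lastCases with
    | last => simp only [Fin.snoc_last]; exact isSemialgebraicFunOn_const_of_isAlgebraic hS hma
    | cast i => simp only [Fin.snoc_castSucc]; exact isSemialgebraicFunOn_apply hS i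
  have hmaps : MapsTo (fun w => (Fin.snoc w m : Fin 3 → ℝ)) S
      {u : Fin 3 → ℝ | u 0 ∈ Ioo (-1:ℝ) 1 ∧ u 1 ∈ Ioo (-1:ℝ) 1 ∧ u 2 ∈ Ioo (0:ℝ) 1} :=
    fun w hwS => ⟨(hw w hwS).1, (hw w hwS).2, hm⟩
  exact ⟨(soloInformed_kummerZeta_sa3_Phi.comp_isSemialgebraicMapOn_holds hφ hmaps).congr
      fun w _ => rfl,
    (soloInformed_kummerZeta_sa3_g.comp_isSemialgebraicMapOn_holds hφ hmaps).congr fun w _ => rfl⟩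

/-- Glueing the closed face `w₁ = 1`: a function semialgebraic on `S ∩ {w₁ < 1}` and vanishing on
`S ∩ {w₁ = 1}` is semialgebraic on `S ⊆ {w₁ ≤ 1}`. [folklore] -/
theorem soloInformed_kummerZeta_sa_face {S : Set (Fin 2 → ℝ)} (hS : IsSemialgebraic ℚ S)
    {F : (Fin 2 → ℝ) → ℝ} (hF : IsSemialgebraicFunOn ℚ (S ∩ {w | w 1 < 1}) F)
    (h1 : ∀ w ∈ S, w 1 = 1 → F w = 0) (hle : ∀ w ∈ S, w 1 ≤ 1) :
    IsSemialgebraicFunOn ℚ S F := by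
  have hZ : IsSemialgebraic ℚ (S ∩ {w : Fin 2 → ℝ | w 1 = 1}) :=
    hS.inter (isSemialgebraic_setOf_apply_eq_of_isAlgebraic isAlgebraic_one 1)
  have h := IsSemialgebraicFunOn.union (F := F) hF
    (isSemialgebraicFunOn_const_of_isAlgebraic hZ isAlgebraic_zero) (fun w _ => rfl)
    (fun w hw => h1 w hw.1 hw.2)
  have hS12 : S ∩ {w : Fin 2 → ℝ | w 1 < 1} ∪ S ∩ {w : Fin 2 → ℝ | w 1 = 1} = S := by
    ext w
    simp only [mem_union, mem_inter_iff, mem_setOf_eq]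
    constructor
    · rintro (⟨h, -⟩ | ⟨h, -⟩) <;> exact h
    · intro hwS
      rcases (hle w hwS).lt_or_eq with h | h
      exacts [Or.inl ⟨hwS, h⟩, Or.inr ⟨hwS, h⟩]
  rw [hS12] at h
  exact h

/-- Closed-range version of `soloInformed_kummerZeta_sa_two`: `S ⊆ (−1,1) × (−1,1]` (on the face
`w₁ = 1` both functions vanish, `(√0)⁻¹ = 0`). [this work] -/
theorem soloInformed_kummerZeta_sa_two' {m : ℝ} (hm : m ∈ Ioo (0:ℝ) 1) (hma : IsAlgebraic ℚ m)
    {S : Set (Fin 2 → ℝ)} (hS : IsSemialgebraic ℚ S)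
    (hw : ∀ w ∈ S, w 0 ∈ Ioo (-1:ℝ) 1 ∧ -1 < w 1 ∧ w 1 ≤ 1) :
    IsSemialgebraicFunOn ℚ S (fun w => soloInformedKummerZetaPhi m (w 0) (w 1)) ∧
    IsSemialgebraicFunOn ℚ S (fun w => soloInformedKummerZetaR m (w 0) (w 1) *
      ((√(1 - w 0 ^ 2))⁻¹ * (√(1 - m * w 0 ^ 2))⁻¹) *
      ((√(1 - w 1 ^ 2))⁻¹ * (√(1 - m * w 1 ^ 2))⁻¹)) := by
  have hS' := hS.inter (isSemialgebraic_setOf_apply_lt_const (n := 2) isAlgebraic_one 1)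
  obtain ⟨hP, hg⟩ := soloInformed_kummerZeta_sa_two hm hma hS'
    fun w hw' => ⟨(hw w hw'.1).1, (hw w hw'.1).2.1, hw'.2⟩
  refine ⟨soloInformed_kummerZeta_sa_face hS hP (fun w _ hw1 => ?_) fun w hwS => (hw w hwS).2.2,
    soloInformed_kummerZeta_sa_face hS hg (fun w _ hw1 => ?_) fun w hwS => (hw w hwS).2.2⟩
  · rw [hw1]; exact soloInformed_kummerZetaPhi_right_one m (w 0)
  · rw [hw1]; simp

/-! ### Integrability on bands inside `(0,1) × [0,1]` -/

/-- `R(w₀,w₁)κ(w₀)κ(w₁)` is integrable on every semialgebraic `S ⊆ (0,1) × [0,1]`, by the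
domination of file I. [this work] -/
theorem soloInformed_kummerZeta_integrableOn_g {m : ℝ} (hm : m ∈ Ioo (0:ℝ) 1)
    (hma : IsAlgebraic ℚ m) {S : Set (Fin 2 → ℝ)} (hS : IsSemialgebraic ℚ S)
    (hw : ∀ w ∈ S, w 0 ∈ Ioo (0:ℝ) 1 ∧ w 1 ∈ Icc (0:ℝ) 1) :
    IntegrableOn (fun w : Fin 2 → ℝ => soloInformedKummerZetaR m (w 0) (w 1) *
      ((√(1 - w 0 ^ 2))⁻¹ * (√(1 - m * w 0 ^ 2))⁻¹) *
      ((√(1 - w 1 ^ 2))⁻¹ * (√(1 - m * w 1 ^ 2))⁻¹)) S := by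
  have hg := (soloInformed_kummerZeta_sa_two' hm hma hS fun w hwS =>
    ⟨⟨by linarith [(hw w hwS).1.1], (hw w hwS).1.2⟩, by linarith [(hw w hwS).2.1],
      (hw w hwS).2.2⟩).2
  have h1m : 0 < 1 - m := by linarith [hm.2]
  have hC : 0 ≤ 6 / (1 - m) ^ 3 := div_nonneg (by norm_num) (pow_nonneg h1m.le 3)
  refine soloInformed_integrableOn_of_le_inv_sqrt_prod hS hg ∅ {0, 1} ∅ {0, 1} (6 / (1 - m) ^ 3)
    ({w | w 1 = 0} ∪ {w | w 1 = 1})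
    (measure_union_null (by rw [volume_pi]; exact Measure.pi_hyperplane _ 1 0)
      (by rw [volume_pi]; exact Measure.pi_hyperplane _ 1 1))
    (fun w hwS hZ j => ?_) (fun w _ hc => ?_)
  · simp only [mem_union, mem_setOf_eq, not_or] at hZ
    fin_cases j
    · exact (hw w hwS).1
    · exact ⟨lt_of_le_of_ne (hw w hwS).2.1 (Ne.symm hZ.1), lt_of_le_of_ne (hw w hwS).2.2 hZ.2⟩
  · have ha := hc 0
    have hb := hc 1
    have hK := soloInformed_kummerZeta_kernel_le hm ⟨ha.1.le, ha.2⟩ ⟨hb.1.le, hb.2⟩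
    have hX : 0 ≤ (√(1 - w 0))⁻¹ * (√(1 - w 1))⁻¹ := by positivity
    rw [Finset.prod_empty, Finset.prod_pair (by decide), one_mul]
    calc |soloInformedKummerZetaR m (w 0) (w 1) * ((√(1 - w 0 ^ 2))⁻¹ * (√(1 - m * w 0 ^ 2))⁻¹) *
          ((√(1 - w 1 ^ 2))⁻¹ * (√(1 - m * w 1 ^ 2))⁻¹)|
        ≤ 6 / (1 - m) ^ 3 * ((√(1 - w 0))⁻¹ * (√(1 - w 1))⁻¹) := hK
      _ ≤ 6 / (1 - m) ^ 3 * ((√(1 - w 0))⁻¹ * (√(1 - w 1))⁻¹ +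
          (√(1 - w 0))⁻¹ * (√(1 - w 1))⁻¹) := by nlinarith [mul_nonneg hC hX]

/-- `|Φ(a,b)| ≤ (1−m)⁻¹ (√(1−a))⁻¹ (√(1−m))⁻¹` for `a ∈ [0,1)`, `b ∈ [0,1]`. [this work] -/
theorem soloInformed_kummerZetaPhi_abs_le {m a b : ℝ} (hm : m ∈ Ioo (0:ℝ) 1)
    (ha : a ∈ Ico (0:ℝ) 1) (hb : b ∈ Icc (0:ℝ) 1) :
    |soloInformedKummerZetaPhi m a b| ≤ (1 - m)⁻¹ * ((√(1 - a))⁻¹ * (√(1 - m))⁻¹) := by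
  have ha2 : a ^ 2 ≤ 1 := by nlinarith [ha.1, ha.2]
  have hb2 : b ^ 2 ≤ 1 := by nlinarith [hb.1, hb.2]
  obtain ⟨hDm, hD⟩ := soloInformed_kummerZeta_denom_pos hm ha2 hb2
  have h1m : 0 < 1 - m := by linarith [hm.2]
  have hκ := soloInformed_kummerZeta_kappa_le hm ha
  have hκ0 : 0 ≤ (√(1 - a ^ 2))⁻¹ * (√(1 - m * a ^ 2))⁻¹ := by positivity
  have hma0 : 0 ≤ m * a ^ 2 := mul_nonneg hm.1.le (sq_nonneg a)
  have hma1 : m * a ^ 2 ≤ 1 := by nlinarith [hm.2]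
  have hs1 : √(1 - b ^ 2) ≤ 1 := by
    rw [show (1:ℝ) = √1 from Real.sqrt_one.symm]
    exact Real.sqrt_le_sqrt (by rw [Real.sqrt_one]; nlinarith)
  have hs2 : √(1 - m * b ^ 2) ≤ 1 := by
    rw [show (1:ℝ) = √1 from Real.sqrt_one.symm]
    exact Real.sqrt_le_sqrt (by rw [Real.sqrt_one]; nlinarith [mul_nonneg hm.1.le (sq_nonneg b)])
  have hn0 : 0 ≤ b * (√(1 - b ^ 2) * √(1 - m * b ^ 2)) :=
    mul_nonneg hb.1 (mul_nonneg (Real.sqrt_nonneg _) (Real.sqrt_nonneg _))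
  have hn1 : b * (√(1 - b ^ 2) * √(1 - m * b ^ 2)) ≤ 1 := by
    calc b * (√(1 - b ^ 2) * √(1 - m * b ^ 2)) ≤ 1 * (1 * 1) :=
          mul_le_mul hb.2 (mul_le_mul hs1 hs2 (Real.sqrt_nonneg _) zero_le_one)
            (mul_nonneg (Real.sqrt_nonneg _) (Real.sqrt_nonneg _)) zero_le_one
      _ = 1 := by ring
  have hq0 : 0 ≤ b * (√(1 - b ^ 2) * √(1 - m * b ^ 2)) / (1 - m * a ^ 2 * b ^ 2) :=
    div_nonneg hn0 hD.le
  have hq : b * (√(1 - b ^ 2) * √(1 - m * b ^ 2)) / (1 - m * a ^ 2 * b ^ 2) ≤ (1 - m)⁻¹ := by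
    rw [div_le_iff₀ hD]
    calc b * (√(1 - b ^ 2) * √(1 - m * b ^ 2)) ≤ 1 := hn1
      _ = (1 - m)⁻¹ * (1 - m) := by field_simp
      _ ≤ (1 - m)⁻¹ * (1 - m * a ^ 2 * b ^ 2) :=
          mul_le_mul_of_nonneg_left hDm (inv_nonneg.2 h1m.le)
  rw [soloInformed_kummerZetaPhi_eq_sqrt, abs_of_nonneg (mul_nonneg (mul_nonneg hma0 hκ0) hq0)]
  calc m * a ^ 2 * ((√(1 - a ^ 2))⁻¹ * (√(1 - m * a ^ 2))⁻¹) *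
        (b * (√(1 - b ^ 2) * √(1 - m * b ^ 2)) / (1 - m * a ^ 2 * b ^ 2))
      ≤ 1 * ((√(1 - a))⁻¹ * (√(1 - m))⁻¹) * (1 - m)⁻¹ :=
        mul_le_mul (mul_le_mul hma1 hκ hκ0 zero_le_one) hq hq0 (by positivity)
    _ = (1 - m)⁻¹ * ((√(1 - a))⁻¹ * (√(1 - m))⁻¹) := by ring

end Summit.KontsevichZagierPeriods.KontsevichZagierPeriods.Theorems

end
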